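import Literature.Analysis.FluidPDE.TypeIAncientMild
import Literature.Analysis.FluidPDE.KNSSTypeIRateMildProofs
import Summits.NavierStokesRegularity.NavierStokesRegularity.Theorems.SqueezeCycleExtremalBiaxialitySubcriticalSmallConstant
import HarnessLib

/-!
# Crux `FarPastLedger` (stmt-NavierStokesRegularity-14060, route SymmetryModuliCount), negative side II: why it resists, exact scale invariance, reductions, exponent rigidity

Negative-side (cdisprove, D-0016) support lemmas extracted from the crux work file
`Cruxes/FarPastLedger/Disproof.lean` (§3, §6) so that ideators / planners / provers can IMPORT them;
companion of `Negative/LoadBearing.lean`.  Everything is stated against `FarPastLedgerStatement`, the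
VERBATIM body of the route declaration `Theses.SymmetryModuliCount.FarPastLedger` (the bridge
`FarPastLedgerStatement ↔ FarPastLedger` is `Iff.rfl`; this file does not import the route module so
that it stays servable while that module is rebuilt).

* WHY IT RESISTS: `farPastLedger_of_classLiouville` (the route target X, i.e. Liouville over the class,
  gives the crux with `K = 0`), `exists_ne_zero_of_not_farPastLedger` (any refutation is a NONZERO
  Type-I KNSS-mild ancient solution — the open Type-I Liouville problem), `farPastLedger_smallConstant`
  (trivially true for `C ≤ ε` by the tree's small-constant Liouville theorem),
  `exists_large_witness_of_not_farPastLedger` (a counterexample constant is `> ε`).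
* EXACT SCALE / TRANSLATION INVARIANCE of the class `A_C = IsTypeIAncientMild C`
  (`isTypeIAncientMild_nsRescale`, `isTypeIAncientMild_translate`) and the scaling law of the local
  energy (`setIntegral_ball_nsRescale`, `setIntegral_ball_translate`).
* REDUCTIONS: crux ⇔ one time slice `t = −1` (`farPastLedger_iff_atNegOne`) ⇔ unit balls, all centres
  (`farPastLedger_iff_unitBalls`) ⇔ unit ball at the origin (`farPastLedger_iff_unitBall`) ⇔ unit ball at
  the origin on the final window `t ∈ (−1,0)` (`farPastLedger_iff_unitBallNearZero`) — the form the lead's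
  line `uloc-gronwall-transplant` proves (`UnitWindowLedger`).
* EXPONENT RIGIDITY: for every `a ≠ 1` the uniform `R^a`-ledger is EQUIVALENT to Liouville over the class
  (`farPastLedgerExp_iff_classLiouville`); `a = 1` is the crux (`farPastLedgerExp_one_iff`).  So no
  "weaker exponent first" strategy exists: every uniform exponent other than the Leray one is already X.

No statement of the route is changed; nothing here closes the item (`--supports`).
-/

noncomputable section

set_option linter.dupNamespace false

namespace Summit.NavierStokesRegularity.NavierStokesRegularity.Theorems.FarPastLedger.Negative

open MeasureTheory Set Filter Metric
open scoped Topology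
open Literature.Analysis.FluidPDE Literature.Analysis.UnboundedOperators

local notation "ℝ³" => EuclideanSpace ℝ (Fin 3)

/-- VERBATIM the body of the route declaration `Theses.SymmetryModuliCount.FarPastLedger`
(stmt-NavierStokesRegularity-14060); `FarPastLedgerStatement ↔ FarPastLedger` is `Iff.rfl`. -/
def FarPastLedgerStatement : Prop :=
  ∀ C : ℝ, ∃ K : ℝ, ∀ (u : ℝ → EuclideanSpace ℝ (Fin 3) → EuclideanSpace ℝ (Fin 3)), Literature.Analysis.FluidPDE.IsTypeIAncientMild C u → ∀ t < 0, ∀ (x₀ : EuclideanSpace ℝ (Fin 3)) (R : ℝ), 0 < R → ∫ x in Metric.ball x₀ R, ‖u t x‖ ^ 2 ≤ K * R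

/-! ## WHY IT RESISTS: the crux follows from the route target `X`; any refutation is a
nonzero Type-I KNSS-mild ancient solution -/

/-- Liouville over the class: every element of every `A_C` vanishes on `t < 0`. -/
def ClassLiouville : Prop :=
  ∀ (C : ℝ) (u : ℝ → ℝ³ → ℝ³), IsTypeIAncientMild C u → ∀ t < 0, ∀ x, u t x = 0

/-- `ClassLiouville` is the route target `Theses.SymmetryModuliCount.TypeIAncientLiouville` (= X) read
through `isTypeIAncientMild_iff` (the right-hand side below is the VERBATIM body of that declaration). -/
theorem classLiouville_iff_typeIAncientLiouville : ClassLiouville ↔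
    ∀ (C : ℝ) (u : ℝ → EuclideanSpace ℝ (Fin 3) → EuclideanSpace ℝ (Fin 3)), ContDiffOn ℝ (⊤ : ℕ∞) (Function.uncurry u) (Set.Iio 0 ×ˢ Set.univ) ∧ (∀ t < 0, Literature.Analysis.FluidPDE.VectorCalculus.IsDivFree (u t)) ∧ (∀ s t : ℝ, s < t → t < 0 → ∀ x, u t x = Literature.Analysis.FluidPDE.heatFlow (u s) (t - s) x - ∫ τ in Set.Ioo s t, ∫ y, Literature.Analysis.FluidPDE.oseenKernel (t - τ) (x - y) (u τ y) (u τ y)) ∧ Literature.Analysis.FluidPDE.HasTypeITimeDecay C u → ∀ t < 0, ∀ x, u t x = 0 := by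
  refine forall_congr' fun C => forall_congr' fun u => ?_
  rw [isTypeIAncientMild_iff]

/-- A ledger with `K = 0` holds at every time slice that vanishes identically (pointwise helper). -/
theorem ledger_of_eq_zero {u : ℝ → ℝ³ → ℝ³} {t : ℝ} (h0 : ∀ x, u t x = 0) (x₀ : ℝ³) (R : ℝ) :
    ∫ x in ball x₀ R, ‖u t x‖ ^ 2 ≤ 0 * R := by
  have h0' : ∀ x, ‖u t x‖ ^ 2 = 0 := fun x => by rw [h0 x, norm_zero]; ring
  simp only [h0', integral_zero, zero_mul, le_refl]

/-- **¬ crux ⇒ ¬ X**: X (Liouville over the class) gives the ledger with `K = 0`, so a refutation of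
the ledger kills the route target itself.  (Contrapositive form: this file proves nothing positive
about the route declaration.) -/
theorem not_classLiouville_of_not_farPastLedger (h : ¬ FarPastLedgerStatement) : ¬ ClassLiouville := by
  intro hL
  exact h fun C => ⟨0, fun u hu t ht x₀ R _ => ledger_of_eq_zero (hL C u hu t ht) x₀ R⟩

/-- **Any counterexample is a NONZERO element of some `A_C`**, i.e. a nontrivial Type-I ancient mild
solution in the KNSS gauge — whose existence is the open Type-I Liouville problem (KNSS2009 §6,
SereginSverak2009 Conj. (L), BradshawTsai2017 OP 5.1).  No explicit field can refute the crux. -/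
theorem exists_ne_zero_of_not_farPastLedger (h : ¬ FarPastLedgerStatement) :
    ∃ (C : ℝ) (u : ℝ → ℝ³ → ℝ³), IsTypeIAncientMild C u ∧ ∃ t < 0, ∃ x, u t x ≠ 0 := by
  have hne := not_classLiouville_of_not_farPastLedger h
  unfold ClassLiouville at hne
  push Not at hne
  exact hne

/-- **Perturbative regime is trivially true**: for `C ≤ ε` the class is `{0}` (tree theorem
`exists_typeIAncientMild_eq_zero_of_small`), so the crux restricted to small constants holds with
`K = 0`; its content sits at large `C`. -/
theorem farPastLedger_smallConstant :
    ∃ ε : ℝ, 0 < ε ∧ ∀ C ≤ ε, ∃ K : ℝ, ∀ (u : ℝ → ℝ³ → ℝ³), IsTypeIAncientMild C u →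
      ∀ t < 0, ∀ (x₀ : ℝ³) (R : ℝ), 0 < R → ∫ x in ball x₀ R, ‖u t x‖ ^ 2 ≤ K * R := by
  obtain ⟨ε, hε, h⟩ :=
    Summit.NavierStokesRegularity.NavierStokesRegularity.Theorems.exists_typeIAncientMild_eq_zero_of_small
  exact ⟨ε, hε, fun C hC => ⟨0, fun u hu t ht x₀ R _ => ledger_of_eq_zero (h C u hu hC t ht) x₀ R⟩⟩

/-- Sharper witness extraction: a counterexample constant is LARGE (`C > ε`). -/
theorem exists_large_witness_of_not_farPastLedger (h : ¬ FarPastLedgerStatement) :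
    ∃ ε : ℝ, 0 < ε ∧ ∃ C : ℝ, ε < C ∧ ∀ K : ℝ, ∃ (u : ℝ → ℝ³ → ℝ³), IsTypeIAncientMild C u ∧
      ∃ t < 0, ∃ (x₀ : ℝ³) (R : ℝ), 0 < R ∧ K * R < ∫ x in ball x₀ R, ‖u t x‖ ^ 2 := by
  obtain ⟨ε, hε, hsmall⟩ := farPastLedger_smallConstant
  unfold FarPastLedgerStatement at h
  push Not at h
  obtain ⟨C, hC⟩ := h
  refine ⟨ε, hε, C, ?_, hC⟩
  by_contra hle
  push Not at hle
  obtain ⟨K, hK⟩ := hsmall C hle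
  obtain ⟨u, hu, t, ht, x₀, R, hR, hlt⟩ := hC K
  exact absurd (hK u hu t ht x₀ R hR) (not_le.2 hlt)

/-! ## EXACT SCALE INVARIANCE of the class and of the ledger; reductions; exponent rigidity -/

/-- `u_c(t,x) = c u(c²t, cx)` is the zoom `c • stPull c² c 0 0 u` of `KNSSTypeIRateMildProofs`. -/
theorem nsRescale_eq_smul_stPull (c : ℝ) (u : ℝ → ℝ³ → ℝ³) :
    nsRescale c u = c • stPull (c ^ 2) c 0 0 u := by
  funext s y
  simp only [nsRescale_apply, Pi.smul_apply, stPull_apply, zero_add]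

/-- **`A_C` is invariant under the parabolic scaling** `u ↦ c u(c²t, cx)`, `c > 0` (same `C`):
smoothness and divergence-freeness transport along the linear substitution, the Oseen equation by
`oseen_smul_stPull` (homogeneity of the Oseen kernel), the rate by `HasTypeITimeDecay.nsRescale`. -/
theorem isTypeIAncientMild_nsRescale {C : ℝ} {u : ℝ → ℝ³ → ℝ³} (h : IsTypeIAncientMild C u) {c : ℝ}
    (hc : 0 < c) : IsTypeIAncientMild C (nsRescale c u) := by
  have hc2 : 0 < c ^ 2 := pow_pos hc 2
  refine ⟨?_, fun t ht => ?_, fun s t hst ht x => ?_, h.hasTypeITimeDecay.nsRescale hc⟩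
  · have e : Function.uncurry (nsRescale c u) =
        fun p : ℝ × ℝ³ => c • Function.uncurry u (c ^ 2 * p.1, c • p.2) := by
      funext p; rfl
    rw [e]
    refine (h.contDiffOn.comp
      ((contDiff_const.mul contDiff_fst).prodMk (contDiff_snd.const_smul c)).contDiffOn
      fun p hp => ?_).const_smul c
    have hp1 : p.1 < 0 := hp.1
    exact mk_mem_prod (mul_neg_of_pos_of_neg hc2 hp1) (mem_univ _)
  · have hct : c ^ 2 * t < 0 := mul_neg_of_pos_of_neg hc2 ht
    have hd : VectorCalculus.IsDivFree (fun x : ℝ³ => u (c ^ 2 * t) (c • x)) :=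
      (h.isDivFree hct).comp_smul c
    have hdiff : Differentiable ℝ (fun x : ℝ³ => u (c ^ 2 * t) (c • x)) :=
      ((h.contDiff_slice hct).differentiable (by simp)).comp (differentiable_id.const_smul c)
    intro x
    have e : nsRescale c u t = fun y => c • (fun z : ℝ³ => u (c ^ 2 * t) (c • z)) y := rfl
    rw [e]
    simp only [VectorCalculus.divergence, fderiv_fun_const_smul (hdiff x) c,
      ContinuousLinearMap.toLinearMap_smul, map_smul, smul_eq_mul]
    have key := hd x
    simp only [VectorCalculus.divergence] at key
    rw [key, mul_zero]
  · have hst' : (0 : ℝ) + c ^ 2 * s < 0 + c ^ 2 * t := by nlinarith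
    have ht' : (0 : ℝ) + c ^ 2 * t < 0 := by nlinarith
    have hu : ∀ X, u (0 + c ^ 2 * t) X = heatExtension (u (0 + c ^ 2 * s)) (0 + c ^ 2 * t - (0 + c ^ 2 * s)) X -
        oseenDuhamel 1 (0 + c ^ 2 * s) u u (0 + c ^ 2 * t) X :=
      fun X => h.mild_eq_heatExtension hst' ht' X
    have key := oseen_smul_stPull hc 0 (0 : ℝ³) hst hu x
    rw [nsRescale_eq_smul_stPull, heatFlow_of_pos _ (sub_pos.2 hst)]
    exact key

/-- **Scaling law of the local energy**: `∫_{B_R(x₀)} |u_c(t)|² = c⁻¹ ∫_{B_{cR}(cx₀)} |u(c²t)|²`;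
with `R ↦ K·R` this makes the ledger EXACTLY scale invariant. -/
theorem setIntegral_ball_nsRescale {c : ℝ} (hc : 0 < c) (u : ℝ → ℝ³ → ℝ³) (t : ℝ) (x₀ : ℝ³) (R : ℝ) :
    ∫ x in ball x₀ R, ‖nsRescale c u t x‖ ^ 2 = c⁻¹ * ∫ y in ball (c • x₀) (c * R), ‖u (c ^ 2 * t) y‖ ^ 2 := by
  have e : ∀ x, ‖nsRescale c u t x‖ ^ 2 = c ^ 2 * (fun y => ‖u (c ^ 2 * t) y‖ ^ 2) (c • x) := fun x => by
    simp only [nsRescale_apply, norm_smul, Real.norm_of_nonneg hc.le, mul_pow]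
  simp_rw [e]
  rw [integral_const_mul, Measure.setIntegral_comp_smul_of_pos volume (fun y => ‖u (c ^ 2 * t) y‖ ^ 2)
    (ball x₀ R) hc, smul_ball hc.ne' x₀ R, Real.norm_of_nonneg hc.le, finrank_euclideanSpace_fin, smul_eq_mul]
  field_simp

/-- ONE-SLICE FORM of the ledger: the time `t = −1` only. -/
def LedgerAtNegOne : Prop :=
  ∀ C : ℝ, ∃ K : ℝ, ∀ (u : ℝ → ℝ³ → ℝ³), IsTypeIAncientMild C u → ∀ (x₀ : ℝ³) (R : ℝ), 0 < R →
    ∫ x in ball x₀ R, ‖u (-1) x‖ ^ 2 ≤ K * R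

/-- **Reduction to one time slice** (scaling `c = √(−t)`): the crux is equivalent to its `t = −1`
instance, uniformly over `A_C`. -/
theorem farPastLedger_iff_atNegOne : FarPastLedgerStatement ↔ LedgerAtNegOne := by
  constructor
  · intro h C
    obtain ⟨K, hK⟩ := h C
    exact ⟨K, fun u hu x₀ R hR => hK u hu (-1) (by norm_num) x₀ R hR⟩
  · intro h C
    obtain ⟨K, hK⟩ := h C
    refine ⟨K, fun u hu t ht x₀ R hR => ?_⟩
    have hl : 0 < Real.sqrt (-t) := Real.sqrt_pos.2 (by linarith)
    set l := Real.sqrt (-t) with hl_def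
    have hl2 : l ^ 2 * (-1) = t := by rw [hl_def, Real.sq_sqrt (by linarith)]; ring
    have key := hK (nsRescale l u) (isTypeIAncientMild_nsRescale hu hl) (l⁻¹ • x₀) (l⁻¹ * R) (by positivity)
    rw [setIntegral_ball_nsRescale hl, smul_smul, mul_inv_cancel₀ hl.ne', one_smul, ← mul_assoc,
      mul_inv_cancel₀ hl.ne', one_mul, hl2] at key
    have key' : l⁻¹ * (∫ x in ball x₀ R, ‖u t x‖ ^ 2) ≤ l⁻¹ * (K * R) :=
      key.trans_eq (by ring)
    exact le_of_mul_le_mul_left key' (inv_pos.2 hl)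

/-- UNIT-BALL FORM: all times, all centres, radius `1`, bound `K` (no `R`). -/
def LedgerUnitBalls : Prop :=
  ∀ C : ℝ, ∃ K : ℝ, ∀ (u : ℝ → ℝ³ → ℝ³), IsTypeIAncientMild C u → ∀ t < 0, ∀ (x₀ : ℝ³),
    ∫ x in ball x₀ 1, ‖u t x‖ ^ 2 ≤ K

/-- **Reduction to unit balls** (scaling `c = R`): the crux says exactly that the energy in unit
balls is bounded over `A_C` UNIFORMLY IN TIME `t ∈ (−∞, 0)` — trivially so for `t ≤ −1`
(`ledger_parabolic_interior`); the content is NO CONCENTRATION OF LOCAL ENERGY AS `t → 0⁻`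
(Albritton–Barker's `A(1) = sup_t ∫_{B₁}|u|² < ∞`, i.e. `u ∈ L^∞_t Ṁ^{2,1}_x = L^∞_t (Morrey
space with the scaling of L³)` uniformly over the class). -/
theorem farPastLedger_iff_unitBalls : FarPastLedgerStatement ↔ LedgerUnitBalls := by
  constructor
  · intro h C
    obtain ⟨K, hK⟩ := h C
    exact ⟨K * 1, fun u hu t ht x₀ => hK u hu t ht x₀ 1 one_pos⟩
  · intro h C
    obtain ⟨K, hK⟩ := h C
    refine ⟨K, fun u hu t ht x₀ R hR => ?_⟩
    have htR : t / R ^ 2 < 0 := div_neg_of_neg_of_pos ht (pow_pos hR 2)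
    have key := hK (nsRescale R u) (isTypeIAncientMild_nsRescale hu hR) (t / R ^ 2) htR (R⁻¹ • x₀)
    have e2 : R ^ 2 * (t / R ^ 2) = t := by field_simp
    rw [setIntegral_ball_nsRescale hR, smul_smul, mul_inv_cancel₀ hR.ne', one_smul, mul_one, e2] at key
    have key' : R⁻¹ * (∫ x in ball x₀ R, ‖u t x‖ ^ 2) ≤ R⁻¹ * (K * R) :=
      key.trans_eq (by field_simp)
    exact le_of_mul_le_mul_left key' (inv_pos.2 hR)

/-- The spatial translate `u(t, x₀ + ·)` is the zoom `1 • stPull 1 1 0 x₀ u`. -/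
theorem translate_eq_smul_stPull (x₀ : ℝ³) (u : ℝ → ℝ³ → ℝ³) :
    (fun t x => u t (x₀ + x)) = (1 : ℝ) • stPull ((1 : ℝ) ^ 2) 1 0 x₀ u := by
  funext s y
  simp only [Pi.smul_apply, stPull_apply, one_pow, one_mul, zero_add, one_smul]

/-- **`A_C` is invariant under spatial translations** (same `C`). -/
theorem isTypeIAncientMild_translate {C : ℝ} {u : ℝ → ℝ³ → ℝ³} (h : IsTypeIAncientMild C u) (x₀ : ℝ³) :
    IsTypeIAncientMild C (fun t x => u t (x₀ + x)) := by
  refine ⟨?_, fun t ht => ?_, fun s t hst ht x => ?_, fun t ht x => h.norm_le ht _⟩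
  · have e : Function.uncurry (fun t x => u t (x₀ + x)) =
        fun p : ℝ × ℝ³ => Function.uncurry u (p.1, x₀ + p.2) := by
      funext p; rfl
    rw [e]
    exact h.contDiffOn.comp (contDiff_fst.prodMk (contDiff_const.add contDiff_snd)).contDiffOn
      fun p hp => mk_mem_prod hp.1 (mem_univ _)
  · intro x
    have key := h.isDivFree ht (x₀ + x)
    simp only [VectorCalculus.divergence] at key ⊢
    rw [fderiv_comp_add_left]
    exact key
  · have hu : ∀ X, u (0 + (1 : ℝ) ^ 2 * t) X =
        heatExtension (u (0 + (1 : ℝ) ^ 2 * s)) (0 + (1 : ℝ) ^ 2 * t - (0 + (1 : ℝ) ^ 2 * s)) X -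
          oseenDuhamel 1 (0 + (1 : ℝ) ^ 2 * s) u u (0 + (1 : ℝ) ^ 2 * t) X := by
      intro X
      simpa using h.mild_eq_heatExtension hst ht X
    have key := oseen_smul_stPull one_pos 0 x₀ hst hu x
    rw [translate_eq_smul_stPull, heatFlow_of_pos _ (sub_pos.2 hst)]
    exact key

/-- Translation of the local energy: `∫_{B_R(0)} |u(t, x₀ + y)|² dy = ∫_{B_R(x₀)} |u(t)|²`. -/
theorem setIntegral_ball_translate (u : ℝ → ℝ³ → ℝ³) (t : ℝ) (x₀ : ℝ³) (R : ℝ) :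
    ∫ y in ball (0 : ℝ³) R, ‖u t (x₀ + y)‖ ^ 2 = ∫ y in ball x₀ R, ‖u t y‖ ^ 2 := by
  rw [← integral_indicator measurableSet_ball, ← integral_indicator measurableSet_ball]
  have e : (ball (0 : ℝ³) R).indicator (fun y => ‖u t (x₀ + y)‖ ^ 2) =
      fun y => (ball x₀ R).indicator (fun y => ‖u t y‖ ^ 2) (x₀ + y) := by
    funext y
    by_cases hy : y ∈ ball (0 : ℝ³) R
    · have hy' : x₀ + y ∈ ball x₀ R := by simpa [mem_ball, dist_eq_norm] using hy
      simp [Set.indicator, hy, hy']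
    · have hy' : x₀ + y ∉ ball x₀ R := by simpa [mem_ball, dist_eq_norm] using hy
      simp [Set.indicator, hy, hy']
  rw [e, integral_add_left_eq_self]

/-- UNIT BALL AT THE ORIGIN, all times: the sharpest target form of the crux. -/
def LedgerUnitBall : Prop :=
  ∀ C : ℝ, ∃ K : ℝ, ∀ (u : ℝ → ℝ³ → ℝ³), IsTypeIAncientMild C u → ∀ t < 0,
    ∫ x in ball (0 : ℝ³) 1, ‖u t x‖ ^ 2 ≤ K

/-- **crux ⇔ `sup_{u ∈ A_C} sup_{t < 0} ∫_{B₁(0)} |u(t)|² < ∞`** (scaling + translation). -/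
theorem farPastLedger_iff_unitBall : FarPastLedgerStatement ↔ LedgerUnitBall := by
  rw [farPastLedger_iff_unitBalls]
  constructor
  · intro h C
    obtain ⟨K, hK⟩ := h C
    exact ⟨K, fun u hu t ht => hK u hu t ht 0⟩
  · intro h C
    obtain ⟨K, hK⟩ := h C
    refine ⟨K, fun u hu t ht x₀ => ?_⟩
    have key := hK _ (isTypeIAncientMild_translate hu x₀) t ht
    rwa [setIntegral_ball_translate u t x₀ 1] at key

/-- FINAL-WINDOW FORM: unit ball at the origin, times `t ∈ (−1, 0)` only. -/
def LedgerUnitBallNearZero : Prop :=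
  ∀ C : ℝ, ∃ K : ℝ, ∀ (u : ℝ → ℝ³ → ℝ³), IsTypeIAncientMild C u → ∀ t ∈ Ioo (-1 : ℝ) 0,
    ∫ x in ball (0 : ℝ³) 1, ‖u t x‖ ^ 2 ≤ K

/-- **The whole content of the crux sits on the final unit window of ANCIENT elements**:
crux ⇔ `sup_{u ∈ A_C} sup_{−1 < t < 0} ∫_{B₁(0)}|u(t)|² < ∞` (for `t ≤ −1` the unit ball is inside the
parabolic interior, `setIntegral_ball_le_typeI`).  Contrast `farPastLedger_false_on_window`
(`Negative/LoadBearing`): the same window statement for the NON-ancient Type-I mild class is false. -/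
theorem farPastLedger_iff_unitBallNearZero : FarPastLedgerStatement ↔ LedgerUnitBallNearZero := by
  rw [farPastLedger_iff_unitBall]
  constructor
  · intro h C
    obtain ⟨K, hK⟩ := h C
    exact ⟨K, fun u hu t ht => hK u hu t ht.2⟩
  · intro h C
    obtain ⟨K, hK⟩ := h C
    refine ⟨max K (C ^ 2 * (ENNReal.toReal (volume (ball (0 : ℝ³) 1)))), fun u hu t ht => ?_⟩
    rcases lt_or_ge (-1 : ℝ) t with h1 | h1
    · exact (hK u hu t ⟨h1, ht⟩).trans (le_max_left _ _)
    · refine le_trans ?_ (le_max_right _ _)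
      have hpt : ∀ x, ‖u t x‖ ^ 2 ≤ C ^ 2 := fun x => by
        have h1' := hu.norm_le ht x
        have hs1 : 1 ≤ Real.sqrt (-t) := by
          rw [← Real.sqrt_one]; exact Real.sqrt_le_sqrt (by linarith)
        have h2 : C / Real.sqrt (-t) ≤ C := div_le_self hu.nonneg hs1
        have h3 : ‖u t x‖ ≤ C := h1'.trans h2
        exact pow_le_pow_left₀ (norm_nonneg _) h3 2
      calc ∫ x in ball (0 : ℝ³) 1, ‖u t x‖ ^ 2 ≤ ∫ _x in ball (0 : ℝ³) 1, C ^ 2 :=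
            integral_mono_of_nonneg (Eventually.of_forall fun x => by positivity)
              (integrableOn_const measure_ball_lt_top.ne) (Eventually.of_forall hpt)
        _ = C ^ 2 * (volume (ball (0 : ℝ³) 1)).toReal := by
            rw [setIntegral_const, smul_eq_mul, measureReal_def, mul_comm]

/-- The ledger with a general exponent `a`: `∫_{B_R(x₀)} |u(t)|² ≤ K R^a`. -/
def FarPastLedgerExp (a : ℝ) : Prop :=
  ∀ C : ℝ, ∃ K : ℝ, ∀ (u : ℝ → ℝ³ → ℝ³), IsTypeIAncientMild C u → ∀ t < 0, ∀ (x₀ : ℝ³) (R : ℝ), 0 < R →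
    ∫ x in ball x₀ R, ‖u t x‖ ^ 2 ≤ K * R ^ a

/-- `a = 1` is the crux. -/
theorem farPastLedgerExp_one_iff : FarPastLedgerExp 1 ↔ FarPastLedgerStatement := by
  simp only [FarPastLedgerExp, FarPastLedgerStatement, Real.rpow_one]

/-- **EXPONENT RIGIDITY.** For every exponent `a ≠ 1` the uniform ledger `∫_{B_R}|u(t)|² ≤ K(C) R^a`
FORCES `A_C = {0}`, i.e. it is the Liouville theorem X itself: scaling a putative element by `c`
improves the constant to `K c^{1−a}`, and `c → 0` (`a < 1`) or `c → ∞` (`a > 1`) kills the unit-ball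
energy.  So the Leray exponent `a = 1` is the ONLY member of the family with content short of X:
the natural strengthening `a < 1` is X in costume, and so is the seemingly weaker `a > 1` (e.g. the
volume rate `a = 3` uniformly in `t`). -/
theorem classLiouville_of_farPastLedgerExp {a : ℝ} (ha : a ≠ 1) (h : FarPastLedgerExp a) :
    ClassLiouville := by
  intro C u hu t ht x
  obtain ⟨K, hK⟩ := h C
  set I := ∫ y in ball x 1, ‖u t y‖ ^ 2 with hI
  -- Step 1: `I ≤ K c^{1-a}` for every `c > 0`
  have hIc : ∀ c : ℝ, 0 < c → I ≤ K * c ^ (1 - a) := by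
    intro c hc
    have hct : t / c ^ 2 < 0 := div_neg_of_neg_of_pos ht (pow_pos hc 2)
    have key := hK (nsRescale c u) (isTypeIAncientMild_nsRescale hu hc) (t / c ^ 2) hct (c⁻¹ • x) c⁻¹
      (inv_pos.2 hc)
    have e2 : c ^ 2 * (t / c ^ 2) = t := by field_simp
    rw [setIntegral_ball_nsRescale hc, smul_smul, mul_inv_cancel₀ hc.ne', one_smul, e2] at key
    have hca : 0 < c ^ a := Real.rpow_pos_of_pos hc a
    have e : K * c⁻¹ ^ a = c⁻¹ * (K * c ^ (1 - a)) := by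
      rw [Real.inv_rpow hc.le, Real.rpow_sub hc, Real.rpow_one]
      field_simp
    rw [e] at key
    exact le_of_mul_le_mul_left key (inv_pos.2 hc)
  -- Step 2: hence `I ≤ 0`
  have hI0 : I ≤ 0 := by
    by_contra hpos
    push Not at hpos
    rcases le_or_gt K 0 with hK0 | hK0
    · have h1 := hIc 1 one_pos
      rw [Real.one_rpow, mul_one] at h1
      linarith
    · have h1a : 1 - a ≠ 0 := sub_ne_zero.2 (Ne.symm ha)
      have hq0 : 0 < I / (2 * K) := by positivity
      have h2 := hIc ((I / (2 * K)) ^ (1 / (1 - a))) (Real.rpow_pos_of_pos hq0 _)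
      rw [← Real.rpow_mul hq0.le, one_div, inv_mul_cancel₀ h1a, Real.rpow_one] at h2
      have h3 : K * (I / (2 * K)) = I / 2 := by field_simp
      linarith
  -- Step 3: `I = 0` and continuity force `u t x = 0`
  by_contra hx
  have hcont : Continuous fun y => ‖u t y‖ ^ 2 := ((hu.continuous_slice ht).norm).pow 2
  have hfx : 0 < ‖u t x‖ ^ 2 := pow_pos (norm_pos_iff.2 hx) 2
  have hIpos : 0 < I := by
    rw [hI, setIntegral_pos_iff_support_of_nonneg_ae (Eventually.of_forall fun y => by positivity)
      ((hcont.continuousOn.integrableOn_compact (isCompact_closedBall x 1)).mono_set ball_subset_closedBall)]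
    refine (IsOpen.inter (isOpen_ne_fun hcont continuous_const) isOpen_ball).measure_pos volume
      ⟨x, ?_, mem_ball_self one_pos⟩
    exact hfx.ne'
  linarith

/-- The rigidity as an equivalence: for `a ≠ 1`, `FarPastLedgerExp a ↔ X` (over the class). -/
theorem farPastLedgerExp_iff_classLiouville {a : ℝ} (ha : a ≠ 1) : FarPastLedgerExp a ↔ ClassLiouville := by
  refine ⟨classLiouville_of_farPastLedgerExp ha, fun hL C => ⟨0, fun u hu t ht x₀ R _ => ?_⟩⟩
  have h0 : ∀ x, ‖u t x‖ ^ 2 = 0 := fun x => by rw [hL C u hu t ht x, norm_zero]; ring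
  simp only [h0, integral_zero, zero_mul, le_refl]


end Summit.NavierStokesRegularity.NavierStokesRegularity.Theorems.FarPastLedger.Negative

end
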